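import Literature.NumberTheory.EllipticCurves.HeegnerPointsClassGroupProofs
import Literature.NumberTheory.QuadraticFields.FormIdealsStructure
import Literature.NumberTheory.QuadraticFields.ClassNumberOneGenus
import HarnessLib

/-!
# Form class number one implies that the ring of integers is principal

Topic `NumberTheory/QuadraticFields`, namespace `Literature.NumberTheory.QuadraticFields.Quadratic`.
Everything here is PROVED (theorems only).

For a quadratic field `K` with integral basis `(1, ω)`, `ω² = m + tω`, `d_K = t² + 4m < 0`:
if the form class number `h(d_K)` is `1` then `𝓞 K` is a principal ideal ring
(`isPrincipalIdealRing_of_binQF_classNumber_eq_one`, and with the tree's other encoding of `h`,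
`isPrincipalIdealRing_of_classNumber_eq_one`). This is the easy half of Cox, *Primes of the form
x² + ny²*, Thm. 7.7 (ii) (`C(d_K) ≅ C(𝓞_K)`, so `h(d_K) = 1 ⟺ 𝓞_K` principal) in the direction
needed for the class number one problem, assembled from the tree: every non-zero ideal is
`(g) · (A, ω − k)` for a form `(A, 2k − t, C)` of discriminant `d_K` (`exists_eq_span_singleton_mul_span_pair`,
`FormIdealsStructure.lean`), such a form is primitive (`isUnit_of_dvd_of_disc_eq`) hence properly
equivalent to the principal form when `h = 1` (`BinQF.properEquiv_of_classNumber_eq_one`), so it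
properly represents `1`, and then `(A, ω − k)` is principal by the ideal-theoretic transformation
rule `sl2_formIdeal_eq` (`EllipticCurves/HeegnerPointsClassGroupProofs.lean`, Cox (7.10)).

## References

* [Cox2013] D. A. Cox, *Primes of the form x² + ny²*, 2nd ed. (2013), §7.B Thm. 7.7 and (7.10).
-/

noncomputable section

open Module NumberField Ideal

namespace Literature.NumberTheory.QuadraticFields.Quadratic

variable {K : Type*} [Field K] [NumberField K]

/-- A form `(A, B, C)` of discriminant `d_K` (w.r.t. an integral basis `(1, ω)`, `ω² = m + tω`) with
`A > 0` is primitive positive definite of discriminant `t² + 4m`. [cite: Cox2013, §7.B Thm. 7.7] -/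
theorem isPosPrim_of_disc_eq (b : Basis (Fin 2) ℤ (𝓞 K)) (hb : b 0 = 1) {t m : ℤ}
    (hω : b 1 * b 1 = (m : 𝓞 K) + (t : 𝓞 K) * b 1) {A B C : ℤ} (hA : 0 < A)
    (hdisc : B ^ 2 - 4 * A * C = t ^ 2 + 4 * m) :
    (⟨A, B, C⟩ : BinQF).IsPosPrim (t ^ 2 + 4 * m) := by
  refine ⟨hdisc, hA, ?_⟩
  -- primitivity: the gcd divides `A, B, C`, hence is a unit
  set d : ℕ := Nat.gcd (Nat.gcd A.natAbs B.natAbs) C.natAbs with hd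
  have hdA : (d : ℤ) ∣ A := Int.natCast_dvd.mpr ((Nat.gcd_dvd_left _ _).trans (Nat.gcd_dvd_left _ _))
  have hdB : (d : ℤ) ∣ B := Int.natCast_dvd.mpr ((Nat.gcd_dvd_left _ _).trans (Nat.gcd_dvd_right _ _))
  have hdC : (d : ℤ) ∣ C := Int.natCast_dvd.mpr (Nat.gcd_dvd_right _ _)
  have hu := isUnit_of_dvd_of_disc_eq b hb hω hdisc hdA hdB hdC
  rw [Int.isUnit_iff_natAbs_eq, Int.natAbs_natCast] at hu
  exact hu

/-- **Form class number one implies `𝓞 K` principal** (the easy direction of Cox, Thm. 7.7 (ii)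
for `h = 1`): for an imaginary quadratic field with integral basis `(1, ω)`, `ω² = m + tω`, if
`h(t² + 4m) = 1` (the tree's `BinQF.classNumber`) then `𝓞 K` is a principal ideal ring.
[cite: Cox2013, §7.B Thm. 7.7] -/
theorem isPrincipalIdealRing_of_binQF_classNumber_eq_one (b : Basis (Fin 2) ℤ (𝓞 K)) (hb : b 0 = 1)
    {t m : ℤ} (hω : b 1 * b 1 = (m : 𝓞 K) + (t : 𝓞 K) * b 1) (hneg : t ^ 2 + 4 * m < 0)
    (h1 : BinQF.classNumber (t ^ 2 + 4 * m) = 1) : IsPrincipalIdealRing (𝓞 K) := by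
  refine ⟨fun I => ?_⟩
  by_cases hI : I = ⊥
  · rw [hI]; exact bot_isPrincipal
  obtain ⟨g, A, k, C, hg, hA, hAC, hIeq⟩ := exists_eq_span_singleton_mul_span_pair b hb hω hI
  -- the form `(A, 2k − t, C)` of discriminant `t² + 4m`
  have hdisc : (2 * k - t) ^ 2 - 4 * A * C = t ^ 2 + 4 * m := by linear_combination (-4 : ℤ) * hAC
  have hpp := isPosPrim_of_disc_eq b hb hω hA hdisc
  have h4 : (t ^ 2 + 4 * m) % 4 = 0 ∨ (t ^ 2 + 4 * m) % 4 = 1 := by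
    rcases Int.even_or_odd t with ⟨r, hr⟩ | ⟨r, hr⟩
    · left
      have : t ^ 2 + 4 * m = 0 + 4 * (r ^ 2 + m) := by rw [hr]; ring
      rw [this, Int.add_mul_emod_self_left]; rfl
    · right
      have : t ^ 2 + 4 * m = 1 + 4 * (r ^ 2 + r + m) := by rw [hr]; ring
      rw [this, Int.add_mul_emod_self_left]; rfl
  -- it is properly equivalent to the principal form, hence properly represents `1`
  obtain ⟨p, q, r, s, hdet, hact⟩ := BinQF.properEquiv_of_classNumber_eq_one hneg h1 hpp
    (BinQF.isPosPrim_omegaForm h4)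
  have hone : A * p ^ 2 + (2 * k - t) * p * r + C * r ^ 2 = 1 := by
    have := congrArg BinQF.a hact
    rw [BinQF.a_act] at this
    simp only [BinQF.omegaForm, BinQF.eval] at this
    linarith
  -- the transformation rule with the inverse matrix `(s, −q; −r, p)`: `A'' = 1`
  have hrule := Literature.NumberTheory.EllipticCurves.sl2_formIdeal_eq b (t := t) (m := m) hω hAC
    (p := s) (q := -q) (r := -r) (s := p) (A'' := 1)
    (k'' := -(A * (-q) * p) + k * (s * p + (-q) * (-r)) - t * (-q) * (-r) - C * s * (-r))
    (by linear_combination hdet) (by linear_combination -hone) rfl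
  rw [Int.cast_one, Ideal.span_singleton_one, Ideal.top_mul] at hrule
  have htop : Ideal.span ({(1 : 𝓞 K), b 1 - ((-(A * (-q) * p) + k * (s * p + (-q) * (-r)) -
      t * (-q) * (-r) - C * s * (-r) : ℤ) : 𝓞 K)} : Set (𝓞 K)) = ⊤ :=
    Ideal.eq_top_of_isUnit_mem _ (Ideal.subset_span (Set.mem_insert _ _)) isUnit_one
  rw [htop, Ideal.mul_top] at hrule
  refine ⟨(g : 𝓞 K) * ((((-r : ℤ)) : 𝓞 K) * (b 1 - k) + (p : 𝓞 K) * A), ?_⟩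
  rw [hIeq, hrule, Ideal.span_singleton_mul_span_singleton, Ideal.submodule_span_eq]

/-- The same with the tree's `BinaryQuadraticForm.classNumber` (number of reduced primitive forms):
**`h(d_K) = 1 ⟹ 𝓞 K` principal**. [cite: Cox2013, §7.B Thm. 7.7] -/
theorem isPrincipalIdealRing_of_classNumber_eq_one (b : Basis (Fin 2) ℤ (𝓞 K)) (hb : b 0 = 1)
    {t m : ℤ} (hω : b 1 * b 1 = (m : 𝓞 K) + (t : 𝓞 K) * b 1) (hneg : t ^ 2 + 4 * m < 0)
    (h1 : BinaryQuadraticForm.classNumber (t ^ 2 + 4 * m) = 1) : IsPrincipalIdealRing (𝓞 K) :=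
  isPrincipalIdealRing_of_binQF_classNumber_eq_one b hb hω hneg
    ((BinaryQuadraticForm.binQF_classNumber_eq _ hneg).trans h1)

end Literature.NumberTheory.QuadraticFields.Quadratic
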